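import Literature.Analysis.FluidPDE.SpaceTimeCalculus
import Literature.Analysis.FluidPDE.WholeSpaceIBP
import Literature.Analysis.FluidPDE.EnergyToolkit
import Literature.Analysis.FluidPDE.LeraySeparationOfEnergyTools
import HarnessLib

/-!
# The cut-off calculus of ROUND-27 «THE √2 APEX» (T27-A′, step (i)–(iii)): energy, enstrophy and
# the Ghidaglia drift bound for `w = φV` (item `TerminalTrace.TypeITraceScarL3`,
# stmt-NavierStokesRegularity-18385, Stub LOUD line; helpers)

Seat nsreg-C26-p1 g2 (cell ns-regularity-ideate), `--supports stmt-NavierStokesRegularity-18385` (helper);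
planner-of-record nsreg-p2 g29 (ROUND-27 §1 (i)–(iv), companion `R27-sqrt2-apex.lean` v2, target T27-A′
`IdentityPackage`).  Pure calculus for a jointly smooth space–time field `V` on an OPEN time set `S` and
a smooth compactly supported cut-off `φ` on `ℝ³`; `w(s) = φ V(s)`.  No Navier–Stokes content.

* `hasDerivAt_integral_norm_sq_cutoff` — `E(s) = ∫ ‖w(s)‖²` is differentiable on `S` with
  `E'(t) = 2 ∫ ⟪w(t), φ ∂ₜV(t)⟫` (differentiation under the integral sign on the compact support,
  tree `hasDerivAt_integral_of_support_subset`).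
* `hasDerivAt_integral_frobeniusNormSq_cutoff` — `D(s) = ∫ |∇w(s)|²_F` is differentiable on `S` with
  `D'(t) = 2 Σᵢ ∫ ⟪∂ᵢw(t), ∂ᵢ(φ ∂ₜV(t))⟫` (`∂ₜ∂ᵢ = ∂ᵢ∂ₜ`, tree `IsSmoothSpaceTimeOn.hasDerivAt_fderiv_slice`).
* slice identities for a smooth compactly supported `W` (Green without boundary, tree
  `integral_inner_laplacian_add_eq_zero`): `Σᵢ ∫ ⟪∂ᵢW, ∂ᵢZ⟫ = −∫ ⟪ΔW, Z⟫`
  (`sum_integral_inner_fderiv_eq_neg_integral_inner_laplacian`), `∫ |∇W|²_F = −∫ ⟪ΔW, W⟫`,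
  the Cauchy–Schwarz consequence `(∫ |∇W|²_F)² ≤ (∫ ‖W‖²)(∫ ‖ΔW‖²)`, the exact cancellation of a
  divergence-free drift `∫ ⟪W, (X·∇)W⟫ = 0` (`integral_inner_convect_self_eq_zero_of_isDivFree`), the
  expansion `∫ ‖ΔW + Λ W‖² = ∫‖ΔW‖² − 2Λ ∫|∇W|²_F + Λ² ∫‖W‖²`, and GHIDAGLIA'S DRIFT BOUND
  `|∫ ⟪A, (X·∇)W⟫| ≤ β (∫‖A‖²)^{1/2} (∫|∇W|²_F)^{1/2}` whenever `‖X‖ ≤ β` on the support of `W`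
  (`|DW(y) X(y)| ≤ |∇W(y)|_F ‖X(y)‖`, tree `norm_sq_le_frobeniusNormSq`).

WHAT THIS IS NOT: not T27-A′, not T27-A, not NS regularity — calculus lemmas.  [folklore; Evans PDE App. C.2;
Ghidaglia 1986; Temam IDDS 1997 §III.6]
-/

noncomputable section

set_option linter.dupNamespace false

namespace Summit.NavierStokesRegularity.NavierStokesRegularity.Theorems.TypeITraceScarL3

open MeasureTheory Set Function Filter Topology Metric InnerProductSpace
open Literature.Analysis.FluidPDE
open scoped RealInnerProductSpace Laplacian ContDiff

/-! ### Slice identities for a smooth compactly supported field -/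

section Slice

variable {W Z A : EuclideanSpace ℝ (Fin 3) → EuclideanSpace ℝ (Fin 3)}
  {X : EuclideanSpace ℝ (Fin 3) → EuclideanSpace ℝ (Fin 3)}

/-- **Green without boundary**: `Σᵢ ∫ ⟪∂ᵢW, ∂ᵢZ⟫ = −∫ ⟪ΔW, Z⟫` for smooth `W, Z` with `W` compactly
supported (the frame is Mathlib's `stdOrthonormalBasis`, the one of `frobeniusNormSq`). [folklore] -/
theorem sum_integral_inner_fderiv_eq_neg_integral_inner_laplacian
    (hW : ContDiff ℝ ∞ W) (hWc : HasCompactSupport W) (hZ : ContDiff ℝ ∞ Z) :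
    ∑ i, ∫ y, ⟪fderiv ℝ W y (stdOrthonormalBasis ℝ (EuclideanSpace ℝ (Fin 3)) i),
        fderiv ℝ Z y (stdOrthonormalBasis ℝ (EuclideanSpace ℝ (Fin 3)) i)⟫ =
      -∫ y, ⟪(Δ W) y, Z y⟫ := by
  have h := integral_inner_laplacian_add_eq_zero (stdOrthonormalBasis ℝ (EuclideanSpace ℝ (Fin 3)))
    (hW.of_le (by norm_cast)) (hZ.of_le (by norm_cast)) (Or.inl hWc)
  linarith

/-- `∫ |∇W|²_F = Σᵢ ∫ ‖∂ᵢW‖²` (finite sum out of the integral). [folklore] -/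
theorem integral_frobeniusNormSq_fderiv_eq_sum (hW : ContDiff ℝ ∞ W) (hWc : HasCompactSupport W) :
    ∫ y, frobeniusNormSq (fderiv ℝ W y) =
      ∑ i, ∫ y, ‖fderiv ℝ W y (stdOrthonormalBasis ℝ (EuclideanSpace ℝ (Fin 3)) i)‖ ^ 2 := by
  have hW1 : ContDiff ℝ 1 W := hW.of_le (by norm_cast)
  have hint : ∀ i, Integrable (fun y => ‖fderiv ℝ W y
      (stdOrthonormalBasis ℝ (EuclideanSpace ℝ (Fin 3)) i)‖ ^ 2)
      (volume : Measure (EuclideanSpace ℝ (Fin 3))) := fun i =>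
    (((hW1.continuous_fderiv one_ne_zero).clm_apply continuous_const).norm.pow 2)
      |>.integrable_of_hasCompactSupport (HasCompactSupport.intro hWc fun y hy => by
        simp [fderiv_of_notMem_tsupport ℝ hy])
  rw [← integral_finsetSum _ fun i _ => hint i]
  rfl

/-- `∫ |∇W|²_F = −∫ ⟪ΔW, W⟫` for smooth compactly supported `W`. [folklore] -/
theorem integral_frobeniusNormSq_fderiv_eq_neg_integral_inner_laplacian
    (hW : ContDiff ℝ ∞ W) (hWc : HasCompactSupport W) :
    ∫ y, frobeniusNormSq (fderiv ℝ W y) = -∫ y, ⟪(Δ W) y, W y⟫ := by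
  rw [integral_frobeniusNormSq_fderiv_eq_sum hW hWc,
    ← sum_integral_inner_fderiv_eq_neg_integral_inner_laplacian hW hWc hW]
  refine Finset.sum_congr rfl fun i _ => integral_congr_ae (Eventually.of_forall fun y => ?_)
  exact (real_inner_self_eq_norm_sq _).symm

/-- **Cauchy–Schwarz for the enstrophy**: `(∫ |∇W|²_F)² ≤ (∫ ‖W‖²) · (∫ ‖ΔW‖²)`. [folklore] -/
theorem sq_integral_frobeniusNormSq_le (hW : ContDiff ℝ ∞ W) (hWc : HasCompactSupport W) :
    (∫ y, frobeniusNormSq (fderiv ℝ W y)) ^ 2 ≤ (∫ y, ‖W y‖ ^ 2) * ∫ y, ‖(Δ W) y‖ ^ 2 := by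
  have hW2 : ContDiff ℝ 2 W := hW.of_le (by norm_cast)
  have hΔc : Continuous (Δ W) := continuous_laplacian hW2
  have hΔs : HasCompactSupport (Δ W) :=
    HasCompactSupport.intro hWc fun y hy => laplacian_eq_zero_of_notMem_tsupport hy
  have hi : Integrable (fun y => ‖(Δ W) y‖ * ‖W y‖) (volume : Measure (EuclideanSpace ℝ (Fin 3))) :=
    (hΔc.norm.mul hW.continuous.norm).integrable_of_hasCompactSupport
      (HasCompactSupport.intro hΔs fun y hy => by simp [image_eq_zero_of_notMem_tsupport hy])
  have habs' : ∫ y, |⟪(Δ W) y, W y⟫| ≤ ∫ y, ‖(Δ W) y‖ * ‖W y‖ :=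
    integral_mono_of_nonneg (ae_of_all _ fun y => abs_nonneg _) hi
      (ae_of_all _ fun y => abs_real_inner_le_norm ((Δ W) y) (W y))
  have habs : |∫ y, ⟪(Δ W) y, W y⟫| ≤ ∫ y, ‖(Δ W) y‖ * ‖W y‖ :=
    le_trans abs_integral_le_integral_abs habs'
  have h1 : ∫ y, frobeniusNormSq (fderiv ℝ W y) ≤ ∫ y, ‖(Δ W) y‖ * ‖W y‖ := by
    rw [integral_frobeniusNormSq_fderiv_eq_neg_integral_inner_laplacian hW hWc]
    exact (neg_le_abs _).trans habs
  have hm1 : MemLp (Δ W) 2 (volume : Measure (EuclideanSpace ℝ (Fin 3))) :=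
    hΔc.memLp_of_hasCompactSupport hΔs
  have hm2 : MemLp W 2 (volume : Measure (EuclideanSpace ℝ (Fin 3))) :=
    hW.continuous.memLp_of_hasCompactSupport hWc
  have h2 : ∫ y, ‖(Δ W) y‖ * ‖W y‖ ≤
      Real.sqrt (∫ y, ‖(Δ W) y‖ ^ 2) * Real.sqrt (∫ y, ‖W y‖ ^ 2) :=
    integral_norm_mul_norm_le_sqrt_mul_sqrt hm1 hm2
  have h0 : 0 ≤ ∫ y, frobeniusNormSq (fderiv ℝ W y) :=
    integral_nonneg fun y => frobeniusNormSq_nonneg _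
  have hQ : 0 ≤ ∫ y, ‖(Δ W) y‖ ^ 2 := integral_nonneg fun y => sq_nonneg _
  have hE : 0 ≤ ∫ y, ‖W y‖ ^ 2 := integral_nonneg fun y => sq_nonneg _
  have h12 := h1.trans h2
  have h3 : (∫ y, frobeniusNormSq (fderiv ℝ W y)) ^ 2 ≤
      (Real.sqrt (∫ y, ‖(Δ W) y‖ ^ 2) * Real.sqrt (∫ y, ‖W y‖ ^ 2)) ^ 2 := by
    rw [pow_two, pow_two]
    exact mul_le_mul h12 h12 h0 (h0.trans h12)
  rw [mul_pow, Real.sq_sqrt hQ, Real.sq_sqrt hE] at h3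
  linarith

/-- **Exact cancellation of a divergence-free drift**: `∫ ⟪W, (X·∇)W⟫ = 0` for smooth compactly
supported `W` and smooth divergence-free `X` (`½∫ X·∇|W|² = −½∫ (div X)|W|² = 0`). [folklore] -/
theorem integral_inner_convect_self_eq_zero_of_isDivFree (hW : ContDiff ℝ ∞ W)
    (hWc : HasCompactSupport W) (hX : ContDiff ℝ ∞ X) (hdiv : VectorCalculus.IsDivFree X) :
    ∫ y, ⟪W y, convect X W y⟫ = 0 := by
  have hW1 : ContDiff ℝ 1 W := hW.of_le (by norm_cast)
  have h := integral_inner_convect_add_eq_zero (hX.of_le (by norm_cast)) hW1 hW1 hWc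
  simp only [hdiv _, zero_mul, integral_zero, add_zero] at h
  have e : ∫ y, ⟪convect X W y, W y⟫ = ∫ y, ⟪W y, convect X W y⟫ :=
    integral_congr_ae (Eventually.of_forall fun y => real_inner_comm _ _)
  linarith

/-- **Expansion of `‖ΔW + ΛW‖²`**: `∫ ‖ΔW + Λ W‖² = ∫‖ΔW‖² − 2Λ ∫|∇W|²_F + Λ² ∫‖W‖²`. [folklore] -/
theorem integral_norm_sq_laplacian_add_smul (hW : ContDiff ℝ ∞ W) (hWc : HasCompactSupport W) (Λ : ℝ) :
    ∫ y, ‖(Δ W) y + Λ • W y‖ ^ 2 =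
      (∫ y, ‖(Δ W) y‖ ^ 2) - 2 * Λ * (∫ y, frobeniusNormSq (fderiv ℝ W y)) + Λ ^ 2 * ∫ y, ‖W y‖ ^ 2 := by
  have hW2 : ContDiff ℝ 2 W := hW.of_le (by norm_cast)
  have hΔc : Continuous (Δ W) := continuous_laplacian hW2
  have hΔs : HasCompactSupport (Δ W) :=
    HasCompactSupport.intro hWc fun y hy => laplacian_eq_zero_of_notMem_tsupport hy
  have e : ∀ y, ‖(Δ W) y + Λ • W y‖ ^ 2 =
      ‖(Δ W) y‖ ^ 2 + 2 * Λ * ⟪(Δ W) y, W y⟫ + Λ ^ 2 * ‖W y‖ ^ 2 := fun y => by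
    rw [← real_inner_self_eq_norm_sq, inner_add_left, inner_add_right, inner_add_right,
      real_inner_smul_left, real_inner_smul_right, real_inner_smul_left, real_inner_smul_right,
      real_inner_self_eq_norm_sq, real_inner_self_eq_norm_sq, real_inner_comm (W y)]
    ring
  have i1 : Integrable (fun y => ‖(Δ W) y‖ ^ 2) (volume : Measure (EuclideanSpace ℝ (Fin 3))) :=
    (hΔc.norm.pow 2).integrable_of_hasCompactSupport
      (HasCompactSupport.intro hΔs fun y hy => by simp [image_eq_zero_of_notMem_tsupport hy])
  have i2 : Integrable (fun y => 2 * Λ * ⟪(Δ W) y, W y⟫) (volume : Measure (EuclideanSpace ℝ (Fin 3))) :=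
    ((hΔc.inner hW.continuous).integrable_of_hasCompactSupport
      (HasCompactSupport.intro hΔs fun y hy => by
        simp [image_eq_zero_of_notMem_tsupport hy])).const_mul _
  have i3 : Integrable (fun y => Λ ^ 2 * ‖W y‖ ^ 2) (volume : Measure (EuclideanSpace ℝ (Fin 3))) :=
    ((hW.continuous.norm.pow 2).integrable_of_hasCompactSupport
      (HasCompactSupport.intro hWc fun y hy => by simp [image_eq_zero_of_notMem_tsupport hy])).const_mul _
  rw [integral_congr_ae (Eventually.of_forall e), integral_add ?_ i3, integral_add i1 i2,
    integral_const_mul, integral_const_mul,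
    integral_frobeniusNormSq_fderiv_eq_neg_integral_inner_laplacian hW hWc]
  · ring
  · exact i1.add i2

/-- **Ghidaglia's drift bound**: if `‖X‖ ≤ β` on the support of the smooth compactly supported `W`,
then `|∫ ⟪A, (X·∇)W⟫| ≤ β (∫‖A‖²)^{1/2} (∫|∇W|²_F)^{1/2}` for every continuous compactly supported `A`
(`‖DW(y) X(y)‖ ≤ |∇W(y)|_F ‖X(y)‖` and Cauchy–Schwarz). [folklore; Ghidaglia 1986] -/
theorem abs_integral_inner_convect_le (hW : ContDiff ℝ ∞ W) (hWc : HasCompactSupport W)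
    (hX : Continuous X) (hA : Continuous A) (hAc : HasCompactSupport A) {β : ℝ} (hβ : 0 ≤ β)
    (hXβ : ∀ y ∈ tsupport W, ‖X y‖ ≤ β) :
    |∫ y, ⟪A y, convect X W y⟫| ≤
      β * Real.sqrt (∫ y, ‖A y‖ ^ 2) * Real.sqrt (∫ y, frobeniusNormSq (fderiv ℝ W y)) := by
  have hW1 : ContDiff ℝ 1 W := hW.of_le (by norm_cast)
  have hDc : Continuous (fderiv ℝ W) := hW1.continuous_fderiv one_ne_zero
  set g : EuclideanSpace ℝ (Fin 3) → ℝ := fun y => Real.sqrt (frobeniusNormSq (fderiv ℝ W y)) with hg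
  have hfc : Continuous fun y => frobeniusNormSq (fderiv ℝ W y) := by
    unfold frobeniusNormSq
    exact continuous_finsetSum _ fun i _ => (hDc.clm_apply continuous_const).norm.pow 2
  have hgc : Continuous g := hfc.sqrt
  have hgs : HasCompactSupport g := by
    refine HasCompactSupport.intro hWc fun y hy => ?_
    simp only [hg, fderiv_of_notMem_tsupport ℝ hy, frobeniusNormSq_zero, Real.sqrt_zero]
  -- pointwise: `‖(X·∇)W (y)‖ ≤ β g(y)`
  have hpt : ∀ y, ‖convect X W y‖ ≤ β * g y := by
    intro y
    by_cases hy : y ∈ tsupport W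
    · calc ‖convect X W y‖ = ‖fderiv ℝ W y (X y)‖ := rfl
        _ ≤ ‖fderiv ℝ W y‖ * ‖X y‖ := ContinuousLinearMap.le_opNorm _ _
        _ ≤ g y * β := by
            refine mul_le_mul ?_ (hXβ y hy) (norm_nonneg _) (Real.sqrt_nonneg _)
            rw [hg, Real.le_sqrt (norm_nonneg _) (frobeniusNormSq_nonneg _)]
            exact norm_sq_le_frobeniusNormSq _
        _ = β * g y := mul_comm _ _
    · have : convect X W y = 0 := by
        show fderiv ℝ W y (X y) = 0
        rw [fderiv_of_notMem_tsupport ℝ hy]; rfl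
      rw [this, norm_zero]
      exact mul_nonneg hβ (Real.sqrt_nonneg _)
  -- Cauchy–Schwarz
  have hAm : MemLp A 2 (volume : Measure (EuclideanSpace ℝ (Fin 3))) :=
    hA.memLp_of_hasCompactSupport hAc
  have hgm : MemLp g 2 (volume : Measure (EuclideanSpace ℝ (Fin 3))) :=
    hgc.memLp_of_hasCompactSupport hgs
  have hCS := integral_norm_mul_norm_le_sqrt_mul_sqrt hAm hgm
  have hg2 : ∫ y, ‖g y‖ ^ 2 = ∫ y, frobeniusNormSq (fderiv ℝ W y) := by
    refine integral_congr_ae (Eventually.of_forall fun y => ?_)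
    simp only [hg, Real.norm_eq_abs, sq_abs, Real.sq_sqrt (frobeniusNormSq_nonneg _)]
  rw [hg2] at hCS
  have hconv : Continuous (convect X W) := by
    have : convect X W = fun y => fderiv ℝ W y (X y) := rfl
    rw [this]; exact hDc.clm_apply hX
  have hi : Integrable (fun y => ‖A y‖ * ‖g y‖) (volume : Measure (EuclideanSpace ℝ (Fin 3))) :=
    (hA.norm.mul hgc.norm).integrable_of_hasCompactSupport
      (HasCompactSupport.intro hAc fun y hy => by simp [image_eq_zero_of_notMem_tsupport hy])
  calc |∫ y, ⟪A y, convect X W y⟫|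
      ≤ ∫ y, |⟪A y, convect X W y⟫| := abs_integral_le_integral_abs
    _ ≤ ∫ y, β * (‖A y‖ * ‖g y‖) := by
        refine integral_mono_of_nonneg (Eventually.of_forall fun y => abs_nonneg _) (hi.const_mul β)
          (Eventually.of_forall fun y => ?_)
        calc |⟪A y, convect X W y⟫| ≤ ‖A y‖ * ‖convect X W y‖ := abs_real_inner_le_norm _ _
          _ ≤ ‖A y‖ * (β * g y) := mul_le_mul_of_nonneg_left (hpt y) (norm_nonneg _)
          _ = β * (‖A y‖ * ‖g y‖) := by
              rw [Real.norm_of_nonneg (Real.sqrt_nonneg _)]; ring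
    _ = β * ∫ y, ‖A y‖ * ‖g y‖ := integral_const_mul _ _
    _ ≤ β * (Real.sqrt (∫ y, ‖A y‖ ^ 2) * Real.sqrt (∫ y, frobeniusNormSq (fderiv ℝ W y))) :=
        mul_le_mul_of_nonneg_left hCS hβ
    _ = _ := by ring

end Slice

/-! ### Time derivatives of the cut-off energy and enstrophy -/

section Time

variable {S : Set ℝ} {V : ℝ → EuclideanSpace ℝ (Fin 3) → EuclideanSpace ℝ (Fin 3)}
  {φ : EuclideanSpace ℝ (Fin 3) → ℝ} {t : ℝ}

/-- The cut-off field `w(s) = φ V(s)` of a jointly smooth field is jointly smooth. [folklore] -/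
theorem isSmoothSpaceTimeOn_cutoff (hV : IsSmoothSpaceTimeOn S V) (hφ : ContDiff ℝ ∞ φ) :
    IsSmoothSpaceTimeOn S fun s y => φ y • V s y :=
  (isSmoothSpaceTimeOn_const_time hφ S).smul hV

/-- The time derivative of the cut-off field is the cut-off of the time derivative:
`∂ₜ(φV)(t, y) = φ(y) ∂ₜV(t, y)`. [folklore] -/
theorem deriv_cutoff_timeLine (hS : IsOpen S) (hV : IsSmoothSpaceTimeOn S V) (ht : t ∈ S)
    (φ : EuclideanSpace ℝ (Fin 3) → ℝ) (y : EuclideanSpace ℝ (Fin 3)) :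
    deriv (fun s => φ y • V s y) t = φ y • deriv (fun s => V s y) t :=
  ((hV.hasDerivAt_timeLine hS ht y).const_smul (φ y)).deriv

/-- **The cut-off energy is differentiable**: `E(s) = ∫ ‖φV(s)‖²` has
`E'(t) = 2 ∫ ⟪φV(t), φ ∂ₜV(t)⟫` at every `t` of the open time set. [folklore] -/
theorem hasDerivAt_integral_norm_sq_cutoff (hS : IsOpen S) (hV : IsSmoothSpaceTimeOn S V)
    (hφ : ContDiff ℝ ∞ φ) (hφc : HasCompactSupport φ) (ht : t ∈ S) :
    HasDerivAt (fun s => ∫ y, ‖φ y • V s y‖ ^ 2)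
      (2 * ∫ y, ⟪φ y • V t y, φ y • deriv (fun s => V s y) t⟫) t := by
  have hw := isSmoothSpaceTimeOn_cutoff hV hφ
  have hΦ : IsSmoothSpaceTimeOn S fun s y => ‖φ y • V s y‖ ^ 2 := by
    have e : (fun s y => ‖φ y • V s y‖ ^ 2) =
        fun s y => (inner ℝ (φ y • V s y) (φ y • V s y) : ℝ) := by
      funext s y; rw [real_inner_self_eq_norm_sq]
    rw [e]; exact hw.inner hw
  have hsupp : ∀ s ∈ S, ∀ y ∉ tsupport φ, ‖φ y • V s y‖ ^ 2 = 0 := by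
    intro s _ y hy
    rw [image_eq_zero_of_notMem_tsupport hy, zero_smul, norm_zero, zero_pow two_ne_zero]
  have hD := hasDerivAt_integral_of_support_subset (μ := volume) hS hΦ hφc hsupp ht
  refine hD.congr_deriv ?_
  rw [← integral_const_mul]
  refine integral_congr_ae (Eventually.of_forall fun y => ?_)
  have hwd : HasDerivAt (fun s => φ y • V s y) (φ y • deriv (fun s => V s y) t) t :=
    (hV.hasDerivAt_timeLine hS ht y).const_smul (φ y)
  have h := hwd.inner ℝ hwd
  have e : (fun s => ‖φ y • V s y‖ ^ 2) = fun s => (inner ℝ (φ y • V s y) (φ y • V s y) : ℝ) := by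
    funext s; rw [real_inner_self_eq_norm_sq]
  show deriv (fun s => ‖φ y • V s y‖ ^ 2) t = _
  rw [e, h.deriv, real_inner_comm (φ y • V t y) (φ y • deriv (fun s => V s y) t)]
  ring

/-- **The cut-off enstrophy is differentiable**: `D(s) = ∫ |∇(φV(s))|²_F` has
`D'(t) = 2 Σᵢ ∫ ⟪∂ᵢ(φV(t)), ∂ᵢ(φ ∂ₜV(t))⟫` at every `t` of the open time set (mixed partials
commute, tree `IsSmoothSpaceTimeOn.hasDerivAt_fderiv_slice`). [folklore] -/
theorem hasDerivAt_integral_frobeniusNormSq_cutoff (hS : IsOpen S) (hV : IsSmoothSpaceTimeOn S V)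
    (hφ : ContDiff ℝ ∞ φ) (hφc : HasCompactSupport φ) (ht : t ∈ S) :
    HasDerivAt (fun s => ∫ y, frobeniusNormSq (fderiv ℝ (fun y => φ y • V s y) y))
      (2 * ∑ i, ∫ y, ⟪fderiv ℝ (fun y => φ y • V t y) y
            (stdOrthonormalBasis ℝ (EuclideanSpace ℝ (Fin 3)) i),
          fderiv ℝ (fun y => φ y • deriv (fun s => V s y) t) y
            (stdOrthonormalBasis ℝ (EuclideanSpace ℝ (Fin 3)) i)⟫) t := by
  set b := stdOrthonormalBasis ℝ (EuclideanSpace ℝ (Fin 3)) with hb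
  have hw := isSmoothSpaceTimeOn_cutoff hV hφ
  -- the partial derivatives as jointly smooth fields
  have hdi : ∀ i, IsSmoothSpaceTimeOn S fun s y => fderiv ℝ (fun y => φ y • V s y) y (b i) :=
    fun i => hw.isSmoothSpaceTimeOn_fderiv_apply hS (b i)
  have hΦi : ∀ i, IsSmoothSpaceTimeOn S fun s y =>
      ‖fderiv ℝ (fun y => φ y • V s y) y (b i)‖ ^ 2 := by
    intro i
    have e : (fun s y => ‖fderiv ℝ (fun y => φ y • V s y) y (b i)‖ ^ 2) =
        fun s y => (inner ℝ (fderiv ℝ (fun y => φ y • V s y) y (b i))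
          (fderiv ℝ (fun y => φ y • V s y) y (b i)) : ℝ) := by
      funext s y; rw [real_inner_self_eq_norm_sq]
    rw [e]; exact (hdi i).inner (hdi i)
  have hΦ : IsSmoothSpaceTimeOn S fun s y => frobeniusNormSq (fderiv ℝ (fun y => φ y • V s y) y) := by
    have e : uncurry (fun s y => frobeniusNormSq (fderiv ℝ (fun y => φ y • V s y) y)) =
        fun z => ∑ i, uncurry (fun s y => ‖fderiv ℝ (fun y => φ y • V s y) y (b i)‖ ^ 2) z := by
      funext z; rfl
    show ContDiffOn ℝ _ _ _
    rw [e]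
    exact ContDiffOn.sum fun i _ => hΦi i
  -- support
  have htsupp : ∀ s, tsupport (fun y => φ y • V s y) ⊆ tsupport φ := fun s =>
    tsupport_smul_subset_left _ _
  have hsupp : ∀ s ∈ S, ∀ y ∉ tsupport φ,
      frobeniusNormSq (fderiv ℝ (fun y => φ y • V s y) y) = 0 := by
    intro s _ y hy
    rw [fderiv_of_notMem_tsupport ℝ (fun h => hy (htsupp s h)), frobeniusNormSq_zero]
  have hD := hasDerivAt_integral_of_support_subset (μ := volume) hS hΦ hφc hsupp ht
  refine hD.congr_deriv ?_
  -- the pointwise time derivative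
  have hderiv_slice : (fun y => deriv (fun s => φ y • V s y) t) =
      fun y => φ y • deriv (fun s => V s y) t := by
    funext y; exact deriv_cutoff_timeLine hS hV ht φ y
  have hpt : ∀ y, deriv (fun s => frobeniusNormSq (fderiv ℝ (fun y => φ y • V s y) y)) t =
      ∑ i, 2 * ⟪fderiv ℝ (fun y => φ y • V t y) y (b i),
        fderiv ℝ (fun y => φ y • deriv (fun s => V s y) t) y (b i)⟫ := by
    intro y
    have hi : ∀ i, HasDerivAt (fun s => ‖fderiv ℝ (fun y => φ y • V s y) y (b i)‖ ^ 2)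
        (2 * ⟪fderiv ℝ (fun y => φ y • V t y) y (b i),
          fderiv ℝ (fun y => φ y • deriv (fun s => V s y) t) y (b i)⟫) t := by
      intro i
      have h1 := hw.hasDerivAt_fderiv_slice hS ht y (b i)
      rw [hderiv_slice] at h1
      have h2 := h1.inner ℝ h1
      have e : (fun s => ‖fderiv ℝ (fun y => φ y • V s y) y (b i)‖ ^ 2) =
          fun s => (inner ℝ (fderiv ℝ (fun y => φ y • V s y) y (b i))
            (fderiv ℝ (fun y => φ y • V s y) y (b i)) : ℝ) := by
        funext s; rw [real_inner_self_eq_norm_sq]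
      rw [e]
      refine h2.congr_deriv ?_
      rw [real_inner_comm (fderiv ℝ (fun y => φ y • V t y) y (b i))
        (fderiv ℝ (fun y => φ y • deriv (fun s => V s y) t) y (b i))]
      ring
    have hsum := HasDerivAt.fun_sum (u := Finset.univ) fun i _ => hi i
    have e2 : (fun s => frobeniusNormSq (fderiv ℝ (fun y => φ y • V s y) y)) =
        fun s => ∑ i ∈ Finset.univ, ‖fderiv ℝ (fun y => φ y • V s y) y (b i)‖ ^ 2 := by
      funext s; rfl
    rw [e2, hsum.deriv]
  rw [integral_congr_ae (Eventually.of_forall hpt)]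
  -- integrability of each summand at time `t`
  have hwt : ContDiff ℝ ∞ (fun y => φ y • V t y) := hw.contDiff_slice ht
  have hzt : ContDiff ℝ ∞ (fun y => φ y • deriv (fun s => V s y) t) := by
    rw [← hderiv_slice]; exact (hw.isSmoothSpaceTimeOn_deriv hS).contDiff_slice ht
  have hwt1 : ContDiff ℝ 1 (fun y => φ y • V t y) := hwt.of_le (by norm_cast)
  have hzt1 : ContDiff ℝ 1 (fun y => φ y • deriv (fun s => V s y) t) := hzt.of_le (by norm_cast)
  have hwtc : HasCompactSupport (fun y => φ y • V t y) := hφc.smul_right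
  have hint : ∀ i, Integrable (fun y => 2 * ⟪fderiv ℝ (fun y => φ y • V t y) y (b i),
      fderiv ℝ (fun y => φ y • deriv (fun s => V s y) t) y (b i)⟫)
      (volume : Measure (EuclideanSpace ℝ (Fin 3))) := by
    intro i
    refine (((((hwt1.continuous_fderiv one_ne_zero).clm_apply continuous_const)).inner
      ((hzt1.continuous_fderiv one_ne_zero).clm_apply continuous_const)).integrable_of_hasCompactSupport
        ?_).const_mul 2
    exact (hwtc.fderiv_apply (𝕜 := ℝ) (b i)).mono fun y hy => by
      contrapose! hy; simp_all
  rw [integral_finsetSum _ fun i _ => hint i, Finset.mul_sum]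
  refine Finset.sum_congr rfl fun i _ => ?_
  rw [integral_const_mul]

end Time

end Summit.NavierStokesRegularity.NavierStokesRegularity.Theorems.TypeITraceScarL3

end
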